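import Summits.CriticalPhenomena.PercolationContinuityZ3.Theorems.PercNearOneGluingNoHeavyQuantFarPendantTreeStem
import HarnessLib

/-!
# QUANT lane R8, front "FAR beyond trees", layer one — BLOCK-LOCALITY, II: the 'block + stem + hair' environment
# (hypothesis `H` of `Block.sharp_medium_of_stemHair` from FAR(1) in two-edge environments)

builds on p205010 (kernel theorem, internal audit signed; external expert review pending)

Support file (`--supports stmt-CriticalPhenomena-4575`), seat `prim-quant-p1` (gen 24); memo
`run/shared/lean/prim/quant/prim-quant-p1-g24/FOR-LEAD-INTRINSIC.md` §2, §6.  Standard axioms; no sorries; no definitions.  Part I: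
`…QuantFarBlockLocalityHair`; part III: `…QuantFarBlockLocality`.  Tools `Block.exists_last_pair_of_reachable`, `Block.real_congr_of_nulls` from
`…QuantFarPendantTreeStem` (the tree instantiation of this file).

HYPOTHESIS `hFAR` ("the block in its TWO-EDGE ENVIRONMENTS satisfies FAR(1)"): for every weight function `w'` agreeing with `w` on the
pairs meeting `Z` and having at most two non-loop pairs of positive weight off `Z` (`∀ e ∈ avoid Z, ¬e.IsDiag → w' e ≠ 0 → e = e₁ ∨ e = e₂`),
every observer `o'`, relay set `A'` and threshold `t'`: `2 < Σ_{A'} P_{w'}(o' ↔ a)` and `P_{w'}(o' ↮ a) ≤ t'` on `A'` imply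
`P_{w'}(#{a ∈ A' : o' ↔ a} ≤ 1) ≤ t'`.  (Such `w'` are the block plus a forest on two extra vertices; for a TREE block they are trees and
`farRelayRow_tree_layerOne` discharges `hFAR` — that instantiation, with the tree bookkeeping, is `…QuantFarPendantTree*`.)
* `Block.stemHair_ineq_of_twoEdgeFAR` — spare vertices `u ≠ b` off `Z ∪ {c}`, `g ∈ (0,1]`, `p ∈ [0,1]`, `2 < p + g·M_in` ⟹
  `min(p, gτ₀) ≤ g·(t_S + p(h_S − t_S))` (`hFAR` on `w̃` = `w` on the block, `g` on the stem `s(u,c)`, `p` on the hair `s(u,b)`, `0` elsewhere,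
  observer `u`, relays `insert b (A ∩ Z)`; the outside coefficients `pg`, `(1−p)g` of `real_two_le_card_eq` are computed on the almost sure event
  that no weight-zero pair is open).
[cite: Grimmett1999, §1.3 p. 10; §2.2] (product measure); [cite: KozmaNitzan2024, Conjecture 3 (p. 15)] (the row); the theorems [this work].
-/

noncomputable section

namespace Summit.CriticalPhenomena.PercolationContinuityZ3.Theorems

namespace Quant

namespace Block

open Finset MeasureTheory Set
open Literature.Probability.LatticeModels
open Literature.Probability.Percolation
open Bundle (offZ avoid offZ_subset real_offZ_event_eq_of_agree)
open scoped Classical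

variable {n : ℕ} {c : Fin n} {Z : Finset (Fin n)}

/-- **The stem + hair inequality from FAR(1) in two-edge environments.**  `w` hangs a block on `Z` at `c`; `hFAR` as in the module docstring;
two spare vertices `u ≠ b` off `Z ∪ {c}`: for every stem weight `g ∈ (0,1]` and hair weight `p ∈ [0,1]` with `2 < p + g·M_in`:
`min(p, g τ₀) ≤ g·(t_S + p(h_S − t_S))`.  The auxiliary weights: `w` on the pairs meeting `Z`, `g` on `s(u,c)`, `p` on `s(u,b)`, `0` elsewhere;
observer `u`, relays `insert b (A ∩ Z)`. [this work] -/
theorem stemHair_ineq_of_twoEdgeFAR (w : Sym2 (Fin n) → unitInterval) (hc : c ∉ Z)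
    (hw : ∀ x y : Fin n, x ≠ y → x ∈ Z → y ∉ Z → y ≠ c → (w s(x, y) : ℝ) = 0)
    (hFAR : ∀ (w' : Sym2 (Fin n) → unitInterval) (e₁ e₂ : Sym2 (Fin n)) (o' : Fin n) (A' : Finset (Fin n)) (t' : ℝ),
      (∀ e, e ∉ avoid Z → w e = w' e) →
      (∀ e ∈ avoid Z, ¬ e.IsDiag → w' e ≠ 0 → e = e₁ ∨ e = e₂) →
      (2 : ℝ) < ∑ a ∈ A', (prodBernoulli w').real (openConn o' a) →
      (∀ a ∈ A', (prodBernoulli w').real (openConn o' a : Set (BondConfig (Fin n)))ᶜ ≤ t') →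
      (prodBernoulli w').real {ω : BondConfig (Fin n) | (A'.filter fun a => ω ∈ openConn o' a).card ≤ 1} ≤ t')
    {u b : Fin n} (huZ : u ∉ Z) (huc : u ≠ c) (hbZ : b ∉ Z) (hbc : b ≠ c) (hub : u ≠ b)
    (A : Finset (Fin n)) {τ₀ : ℝ} (hτ₀ : ∀ a ∈ A ∩ Z, τ₀ ≤ (prodBernoulli w).real {ω | onZ Z ω ∈ openConn c a})
    {g p : ℝ} (hg0 : 0 < g) (hg1 : g ≤ 1) (hp0 : 0 ≤ p) (hp1 : p ≤ 1)
    (hEN : 2 < p + g * ∑ a ∈ A ∩ Z, (prodBernoulli w).real {ω | onZ Z ω ∈ openConn c a}) :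
    min p (g * τ₀) ≤ g * ((prodBernoulli w).real {ω | 2 ≤ ((A ∩ Z).filter fun a => onZ Z ω ∈ openConn c a).card} +
      p * ((prodBernoulli w).real {ω | 1 ≤ ((A ∩ Z).filter fun a => onZ Z ω ∈ openConn c a).card} -
        (prodBernoulli w).real {ω | 2 ≤ ((A ∩ Z).filter fun a => onZ Z ω ∈ openConn c a).card})) := by
  have hmeas : ∀ U : Set (BondConfig (Fin n)), MeasurableSet U := fun U => (Set.toFinite U).measurableSet
  set pU : unitInterval := ⟨p, hp0, hp1⟩ with hpU
  set gU : unitInterval := ⟨g, hg0.le, hg1⟩ with hgU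
  set w' : Sym2 (Fin n) → unitInterval :=
    fun e => if e ∈ avoid Z then (if e = s(u, c) then gU else if e = s(u, b) then pU else 0) else w e with hw'
  have hmem_avoid : ∀ x y : Fin n, s(x, y) ∈ avoid Z ↔ x ∉ Z ∧ y ∉ Z := by
    intro x y
    rw [Bundle.avoid, Finset.mem_filter]
    constructor
    · intro h; exact ⟨fun hx => h.2 x hx (Sym2.mem_mk_left _ _), fun hy => h.2 y hy (Sym2.mem_mk_right _ _)⟩
    · rintro ⟨hx, hy⟩
      refine ⟨Finset.mem_univ _, fun z hz hzm => ?_⟩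
      rcases Sym2.mem_iff.1 hzm with rfl | rfl
      · exact hx hz
      · exact hy hz
  have hagree : ∀ e, e ∉ avoid Z → w e = w' e := by
    intro e he; simp only [hw', he, if_false]
  have hucb : s(u, c) ≠ s(u, b) := by
    intro h
    rcases Sym2.eq_iff.1 h with ⟨_, h2⟩ | ⟨h1, _⟩
    · exact hbc h2.symm
    · exact hub h1
  have hw'uc : w' s(u, c) = gU := by
    have : s(u, c) ∈ avoid Z := (hmem_avoid u c).2 ⟨huZ, hc⟩
    simp only [hw', this, if_true]
  have hw'ub : w' s(u, b) = pU := by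
    have : s(u, b) ∈ avoid Z := (hmem_avoid u b).2 ⟨huZ, hbZ⟩
    simp only [hw', this, if_true, hucb.symm, if_false]
  have hw'zero : ∀ e, e ∈ avoid Z → e ≠ s(u, c) → e ≠ s(u, b) → w' e = 0 := by
    intro e he h1 h2; simp only [hw', he, h1, h2, if_true, if_false]
  have hw'hang : ∀ x y : Fin n, x ≠ y → x ∈ Z → y ∉ Z → y ≠ c → (w' s(x, y) : ℝ) = 0 := by
    intro x y hxy hx hy hyc
    have : s(x, y) ∉ avoid Z := fun h => ((hmem_avoid x y).1 h).1 hx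
    rw [← hagree _ this]; exact hw x y hxy hx hy hyc
  set μ := prodBernoulli w with hμ
  set μ' := prodBernoulli w' with hμ'
  have hblk : ∀ P : BondConfig (Fin n) → Prop, μ'.real {ω | P (onZ Z ω)} = μ.real {ω | P (onZ Z ω)} :=
    fun P => (real_onZ_event_eq_of_agree w w' Z hagree P).symm
  set hS := μ.real {ω | 1 ≤ ((A ∩ Z).filter fun a => onZ Z ω ∈ openConn c a).card} with hhS
  set tS := μ.real {ω | 2 ≤ ((A ∩ Z).filter fun a => onZ Z ω ∈ openConn c a).card} with htS
  set M := ∑ a ∈ A ∩ Z, μ.real {ω | onZ Z ω ∈ openConn c a} with hMdef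
  have hτa : ∀ a ∈ A ∩ Z, μ'.real {ω | onZ Z ω ∈ openConn c a} = μ.real {ω | onZ Z ω ∈ openConn c a} :=
    fun a _ => hblk fun η => η ∈ openConn c a
  have hhS' : μ'.real {ω | 1 ≤ ((A ∩ Z).filter fun a => onZ Z ω ∈ openConn c a).card} = hS :=
    hblk fun η => 1 ≤ ((A ∩ Z).filter fun a => η ∈ openConn c a).card
  have htS' : μ'.real {ω | 2 ≤ ((A ∩ Z).filter fun a => onZ Z ω ∈ openConn c a).card} = tS :=
    hblk fun η => 2 ≤ ((A ∩ Z).filter fun a => η ∈ openConn c a).card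
  -- relay set
  set A' : Finset (Fin n) := insert b (A ∩ Z) with hA'
  have hbAZ : b ∉ A ∩ Z := fun h => hbZ (Finset.mem_inter.1 h).2
  have hsd : A' \ Z = {b} := by
    ext x
    simp only [hA', Finset.mem_sdiff, Finset.mem_insert, Finset.mem_inter, Finset.mem_singleton]
    constructor
    · rintro ⟨h1 | h1, h2⟩
      · exact h1
      · exact absurd h1.2 h2
    · intro hx; subst hx; exact ⟨Or.inl rfl, hbZ⟩
  have hin : A' ∩ Z = A ∩ Z := by
    ext x
    simp only [hA', Finset.mem_inter, Finset.mem_insert]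
    constructor
    · rintro ⟨h1 | h1, h2⟩
      · subst h1; exact absurd h2 hbZ
      · exact ⟨h1.1, h2⟩
    · rintro ⟨h1, h2⟩; exact ⟨Or.inr ⟨h1, h2⟩, h2⟩
  -- clean configurations: no open pair of `avoid Z` other than the stem and the hair
  set Bd : Finset (Sym2 (Fin n)) := (avoid Z).filter fun e => e ≠ s(u, c) ∧ e ≠ s(u, b) with hBd
  have hBd0 : ∀ e ∈ Bd, (w' e : ℝ) = 0 := by
    intro e he
    rw [hBd, Finset.mem_filter] at he
    rw [hw'zero e he.1 he.2.1 he.2.2]; rfl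
  have hclean : ∀ ω : BondConfig (Fin n), (∀ e ∈ Bd, e ∉ ω) → ∀ e ∈ offZ Z ω, e = s(u, c) ∨ e = s(u, b) := by
    intro ω hω e he
    have heω : e ∈ ω := (offZ_subset Z ω) he
    have hea : e ∈ avoid Z := by
      rw [Bundle.avoid, Finset.mem_filter]; exact ⟨Finset.mem_univ _, he.2⟩
    by_contra hne
    have : e ∈ Bd := by
      rw [hBd, Finset.mem_filter]
      exact ⟨hea, fun h => hne (Or.inl h), fun h => hne (Or.inr h)⟩
    exact hω e this heω
  -- on clean configurations: `u ↔ c off Z ↔ s(u,c) open`, `u ↔ b off Z ↔ s(u,b) open`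
  have hJiff : ∀ ω : BondConfig (Fin n), (∀ e ∈ Bd, e ∉ ω) → (offZ Z ω ∈ openConn u c ↔ s(u, c) ∈ ω) := by
    intro ω hω
    constructor
    · intro h
      obtain ⟨z, hzc, hz⟩ := exists_last_pair_of_reachable h huc
      rcases hclean ω hω _ hz with h1 | h1
      · rw [← h1]; exact (offZ_subset Z ω) hz
      · exfalso
        have : c ∈ s(u, b) := by rw [← h1]; exact Sym2.mem_mk_right _ _
        rcases Sym2.mem_iff.1 this with h2 | h2
        · exact huc h2.symm
        · exact hbc h2.symm
    · intro h
      have hmem : s(u, c) ∈ offZ Z ω := ⟨h, fun z hz hzm => by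
        rcases Sym2.mem_iff.1 hzm with rfl | rfl
        · exact huZ hz
        · exact hc hz⟩
      exact SimpleGraph.Adj.reachable ((openGraph_adj _ _ _).2 ⟨hmem, huc⟩)
  have hBiff : ∀ ω : BondConfig (Fin n), (∀ e ∈ Bd, e ∉ ω) → (offZ Z ω ∈ openConn u b ↔ s(u, b) ∈ ω) := by
    intro ω hω
    constructor
    · intro h
      obtain ⟨z, hzb, hz⟩ := exists_last_pair_of_reachable h hub
      rcases hclean ω hω _ hz with h1 | h1
      · exfalso
        have : b ∈ s(u, c) := by rw [← h1]; exact Sym2.mem_mk_right _ _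
        rcases Sym2.mem_iff.1 this with h2 | h2
        · exact hub h2.symm
        · exact hbc h2
      · rw [← h1]; exact (offZ_subset Z ω) hz
    · intro h
      have hmem : s(u, b) ∈ offZ Z ω := ⟨h, fun z hz hzm => by
        rcases Sym2.mem_iff.1 hzm with rfl | rfl
        · exact huZ hz
        · exact hbZ hz⟩
      exact SimpleGraph.Adj.reachable ((openGraph_adj _ _ _).2 ⟨hmem, hub⟩)
  -- the three outside probabilities
  have hg' : μ'.real {ω : BondConfig (Fin n) | offZ Z ω ∈ openConn u c} = g := by
    rw [real_congr_of_nulls w' Bd hBd0 _ {ω | s(u, c) ∈ ω} (fun ω hω => by simp only [mem_setOf_eq]; exact hJiff ω hω),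
      prodBernoulli_real_setOf_mem, hw'uc]
  have hdetc : DeterminedBy {ω : BondConfig (Fin n) | s(u, c) ∈ ω} (↑({s(u, c)} : Finset (Sym2 (Fin n)))) := var2083_det_mem _
  have hBval : μ'.real {ω : BondConfig (Fin n) | (({b} : Finset (Fin n)).filter fun a => offZ Z ω ∈ openConn u a).card = 1 ∧
      offZ Z ω ∈ openConn u c} = p * g := by
    rw [real_congr_of_nulls w' Bd hBd0 _ ({ω | s(u, b) ∈ ω} ∩ {ω | s(u, c) ∈ ω}) (fun ω hω => by
      simp only [mem_setOf_eq, Set.mem_inter_iff, Finset.filter_singleton]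
      rw [← hBiff ω hω, ← hJiff ω hω]
      constructor
      · rintro ⟨h1, h2⟩
        refine ⟨?_, h2⟩
        by_contra hnb; rw [if_neg hnb, Finset.card_empty] at h1; exact absurd h1 (by norm_num)
      · rintro ⟨h1, h2⟩; rw [if_pos h1, Finset.card_singleton]; exact ⟨rfl, h2⟩)]
    rw [Bundle.real_mem_inter w' s(u, b) (F := {s(u, c)}) (by rw [Finset.mem_singleton]; exact hucb.symm) hdetc,
      prodBernoulli_real_setOf_mem, hw'ub, hw'uc]
  have hCval : μ'.real {ω : BondConfig (Fin n) | (({b} : Finset (Fin n)).filter fun a => offZ Z ω ∈ openConn u a).card = 0 ∧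
      offZ Z ω ∈ openConn u c} = (1 - p) * g := by
    rw [real_congr_of_nulls w' Bd hBd0 _ ({ω | s(u, b) ∉ ω} ∩ {ω | s(u, c) ∈ ω}) (fun ω hω => by
      simp only [mem_setOf_eq, Set.mem_inter_iff, Finset.filter_singleton]
      rw [← hBiff ω hω, ← hJiff ω hω]
      constructor
      · rintro ⟨h1, h2⟩
        refine ⟨?_, h2⟩
        intro hb; rw [if_pos hb, Finset.card_singleton] at h1; exact absurd h1 (by norm_num)
      · rintro ⟨h1, h2⟩; rw [if_neg h1, Finset.card_empty]; exact ⟨rfl, h2⟩)]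
    rw [Bundle.real_notMem_inter w' s(u, b) (F := {s(u, c)}) (by rw [Finset.mem_singleton]; exact hucb.symm) hdetc,
      prodBernoulli_real_setOf_mem, hw'ub, hw'uc]
  have hA0 : μ'.real {ω : BondConfig (Fin n) | 2 ≤ (({b} : Finset (Fin n)).filter fun a => offZ Z ω ∈ openConn u a).card} = 0 := by
    have : {ω : BondConfig (Fin n) | 2 ≤ (({b} : Finset (Fin n)).filter fun a => offZ Z ω ∈ openConn u a).card} = ∅ := by
      rw [Set.eq_empty_iff_forall_notMem]
      intro ω hω
      have h1 : (({b} : Finset (Fin n)).filter fun a => offZ Z ω ∈ openConn u a).card ≤ 1 :=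
        (Finset.card_filter_le _ _).trans (by rw [Finset.card_singleton])
      simp only [mem_setOf_eq] at hω; omega
    rw [this, measureReal_empty]
  -- marginals: `P(u ↔ b) = p`, `P(u ↔ a) = g·τ_a`
  have huu1 : μ'.real (openConn u u) = 1 := by
    have : (openConn u u : Set (BondConfig (Fin n))) = Set.univ := Set.eq_univ_of_forall fun _ => SimpleGraph.Reachable.refl _
    rw [this]; exact probReal_univ
  have hpend : ∀ x : Fin n, x ≠ b → x ≠ u → w' s(b, x) = 0 := by
    intro x hxb hxu
    by_cases hxZ : x ∈ Z
    · have hna : s(b, x) ∉ avoid Z := fun h => ((hmem_avoid b x).1 h).2 hxZ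
      rw [← hagree _ hna]
      have h0 : (w s(x, b) : ℝ) = 0 := hw x b hxb hxZ hbZ hbc
      rw [Sym2.eq_swap]
      exact Subtype.ext (by rw [h0]; rfl)
    · have ha : s(b, x) ∈ avoid Z := (hmem_avoid b x).2 ⟨hbZ, hxZ⟩
      have hne1 : s(b, x) ≠ s(u, c) := by
        intro h
        rcases Sym2.eq_iff.1 h with ⟨h1, _⟩ | ⟨h1, _⟩
        · exact hub h1.symm
        · exact hbc h1
      have hne2 : s(b, x) ≠ s(u, b) := by
        intro h
        rcases Sym2.eq_iff.1 h with ⟨h1, _⟩ | ⟨_, h2⟩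
        · exact hub h1.symm
        · exact hxu h2
      exact hw'zero _ ha hne1 hne2
  have hmargb : μ'.real (openConn u b) = p := by
    have h1 := Bundle.real_openConn_of_pendant_observer w' hub.symm hpend (a := u) hub
    have hsymm : (openConn u b : Set (BondConfig (Fin n))) = openConn b u :=
      Set.ext fun _ => ⟨SimpleGraph.Reachable.symm, SimpleGraph.Reachable.symm⟩
    rw [hsymm, h1, huu1, mul_one, Sym2.eq_swap, hw'ub]
  have hmargZ : ∀ a ∈ A ∩ Z, μ'.real (openConn u a) = g * μ.real {ω | onZ Z ω ∈ openConn c a} := by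
    intro a ha
    rw [real_openConn_in_eq (o := u) w' huZ hc hw'hang (Finset.mem_inter.1 ha).2, hg', hτa a ha]
  -- FAR on the auxiliary tree
  have hsum : ∑ a ∈ A', μ'.real (openConn u a) = p + g * M := by
    rw [hA', Finset.sum_insert hbAZ, hmargb, Finset.sum_congr rfl hmargZ, ← Finset.mul_sum]
  have hEN' : (2 : ℝ) < ∑ a ∈ A', μ'.real (openConn u a) := by rw [hsum]; exact hEN
  have hcut' : ∀ a ∈ A', μ'.real (openConn u a : Set (BondConfig (Fin n)))ᶜ ≤ 1 - min p (g * τ₀) := by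
    intro a ha
    rw [probReal_compl_eq_one_sub (hmeas _)]
    rw [hA', Finset.mem_insert] at ha
    rcases ha with rfl | ha
    · rw [hmargb]; linarith [min_le_left p (g * τ₀)]
    · rw [hmargZ a ha]
      have : g * τ₀ ≤ g * μ.real {ω | onZ Z ω ∈ openConn c a} := mul_le_mul_of_nonneg_left (hτ₀ a ha) hg0.le
      linarith [min_le_right p (g * τ₀)]
  have htwo : ∀ e ∈ avoid Z, ¬ e.IsDiag → w' e ≠ 0 → e = s(u, c) ∨ e = s(u, b) := by
    intro e he _ hne
    by_contra hcon
    exact hne (hw'zero e he (fun h => hcon (Or.inl h)) (fun h => hcon (Or.inr h)))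
  have hFAR' := hFAR w' s(u, c) s(u, b) u A' (1 - min p (g * τ₀)) hagree htwo hEN' hcut'
  have hD := real_two_le_card_eq (o := u) w' huZ hc hw'hang A'
  rw [hsd, hin] at hD
  rw [hA0, hBval, hCval, hhS', htS'] at hD
  have hc2 := real_card_le_one_eq_one_sub μ' A' u
  rw [hc2, hD] at hFAR'
  nlinarith

end Block
end Quant
end Summit.CriticalPhenomena.PercolationContinuityZ3.Theorems
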